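import Literature.NumberTheory.LFunctions.YoshidaWindowGramEntryBox
import HarnessLib

/-!
# Format C, design C∞ (E2c, data side): the Hankel-table checker — from CLAIMED entry tables to the `hH` boxes of the door glue

Route context: Fourier–Galerkin / Schur-complement certificates of Weil positivity on a window ("format C", C∞ door;
cell memo `run/shared/lean/pub/rh-explicit/rh-explicit-weil-2/gen15/E2-PLAN-v2.md` §6.7; supporting stmt-RiemannHypothesis-0098;
seat rh-explicit-weil-2).  `cinf_sum_Ico_sq_le_of_hankel_boxes` (`WeilFormatCCinfGramHankel`) wants, for the four tags and
`2 ≤ s ≤ 2D`, real numbers `Hmid t t' s`, `Hrad t t' s` with `|X t t' s − Hmid| ≤ Hrad` (X = the Hankel tail sum) and `Hrad`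
symmetric in the tags.  The generator emits a CLAIMED table `tab t t' s : MI` (literal integers at scale `S`); the kernel has an
EVALUATOR `E t t' s : MI ∋ X t t' s` (range + far tail, `WeilFormatCCinfGramRange` & co.).  Here:

* `CinfCoeff.checkHankel E tab D : Bool` — for `t, t' < 4`, `s ≤ 2D`: `tab t t' s = tab t' t s`, and for `2 ≤ s`: `E t t' s ⊆ tab t t' s`
  (`Encl.within`); one `decide`/`rfl` per rung;
* `CinfCoeff.hankel_of_check` — soundness: with `Hmid := (lo+hi)/(2S)`, `Hrad := (hi−lo)/(2S)` read off `tab` (and `0` beyond `2D`),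
  the three inputs `hH`, `hsym` of the glue lemma hold.

Usage (composition test `gen15/e2/HankelCompose.lean`, rc 0): `obtain ⟨hH, hsym⟩ := hankel_of_check hS hE hcheck;
exact cinf_sum_Ico_sq_le_of_hankel_boxes hm₀ T hT (tabMid S tab D) (tabRad S tab D) hH hsym ν hν N u` is the door's `hΓe`.
Generic in the entry function `X`; interval bookkeeping only; standard axioms; no RH claim.
-/

set_option autoImplicit false
-- `Summit.RiemannHypothesis.RiemannHypothesis.…` is the layout-mandated namespace (summit = problem name).
set_option linter.dupNamespace false

namespace Summit.RiemannHypothesis.RiemannHypothesis.Theorems.WeilFormatC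

open Literature.Analysis.ValidatedNumerics Literature.Analysis.ValidatedNumerics.NumericsMP
open Literature.NumberTheory.LFunctions.Yoshida1992 (Encl.within Encl.mem_of_within)

namespace CinfCoeff

variable {S : ℕ}

/-- **The Hankel-table checker**: tag symmetry of the claimed table for every `s ≤ 2D`, and containment of the evaluator box in
the claimed box for `2 ≤ s ≤ 2D`. -/
def checkHankel (E tab : ℕ → ℕ → ℕ → MI) (D : ℕ) : Bool :=
  (List.range 4).all fun t ↦ (List.range 4).all fun t' ↦ (List.range (2 * D + 1)).all fun s ↦
    decide (tab t t' s = tab t' t s) && (decide (s < 2) || Encl.within (E t t' s) (tab t t' s))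

/-- The midpoint of a claimed box, as a real number (`0` beyond `2D`). -/
noncomputable def tabMid (S : ℕ) (tab : ℕ → ℕ → ℕ → MI) (D : ℕ) (t t' : Fin 4) (s : ℕ) : ℝ :=
  if s ≤ 2 * D then (((tab t t' s).lo : ℝ) + (tab t t' s).hi) / (2 * S) else 0

/-- The radius of a claimed box, as a real number (`0` beyond `2D`). -/
noncomputable def tabRad (S : ℕ) (tab : ℕ → ℕ → ℕ → MI) (D : ℕ) (t t' : Fin 4) (s : ℕ) : ℝ :=
  if s ≤ 2 * D then (((tab t t' s).hi : ℝ) - (tab t t' s).lo) / (2 * S) else 0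

/-- A fixed-point box as a (mid, rad) pair (local copy of `cinf_abs_sub_mid_le_of_mem`, whose module may lack an olean). -/
private theorem abs_sub_mid_le_of_mem_loc (hS : 0 < S) {x : ℝ} {B : MI} (h : MI.mem S x B) :
    |x - ((B.lo : ℝ) + B.hi) / (2 * S)| ≤ ((B.hi : ℝ) - B.lo) / (2 * S) := by
  have hS' : (0 : ℝ) < S := by exact_mod_cast hS
  have h1 : (B.lo : ℝ) ≤ x * S := h.1
  have h2 : x * S ≤ (B.hi : ℝ) := h.2
  have e : x - ((B.lo : ℝ) + B.hi) / (2 * S) = (2 * (x * S) - ((B.lo : ℝ) + B.hi)) / (2 * S) := by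
    field_simp
  rw [e, abs_div, abs_of_pos (by positivity : (0 : ℝ) < 2 * S), div_le_div_iff_of_pos_right (by positivity),
    abs_le]
  constructor <;> linarith

/-- **Soundness of `checkHankel`**: the evaluator's memberships on `2 ≤ s ≤ 2D` and a passing check give the `hH` boxes
(with `tabMid`/`tabRad`) and the tag symmetry of `tabRad` for EVERY `s`. -/
theorem hankel_of_check (hS : 0 < S) {X : Fin 4 → Fin 4 → ℕ → ℝ} {D : ℕ} {E tab : ℕ → ℕ → ℕ → MI}
    (hE : ∀ (t t' : Fin 4) (s : ℕ), 2 ≤ s → s ≤ 2 * D → MI.mem S (X t t' s) (E t t' s))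
    (h : checkHankel E tab D = true) :
    (∀ (t t' : Fin 4) (s : ℕ), 2 ≤ s → s ≤ 2 * D →
        |X t t' s - tabMid S tab D t t' s| ≤ tabRad S tab D t t' s) ∧
      ∀ (t t' : Fin 4) (s : ℕ), tabRad S tab D t t' s = tabRad S tab D t' t s := by
  unfold checkHankel at h
  have hget : ∀ (t t' : Fin 4) (s : ℕ), s ≤ 2 * D →
      tab t t' s = tab t' t s ∧ (s < 2 ∨ Encl.within (E t t' s) (tab t t' s) = true) := by
    intro t t' s hs
    rw [List.all_eq_true] at h
    have h1 := h t (List.mem_range.2 t.isLt)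
    rw [List.all_eq_true] at h1
    have h2 := h1 t' (List.mem_range.2 t'.isLt)
    rw [List.all_eq_true] at h2
    have h3 := h2 s (List.mem_range.2 (by omega))
    simp only [Bool.and_eq_true, Bool.or_eq_true, decide_eq_true_eq] at h3
    exact h3
  refine ⟨fun t t' s hs2 hsD ↦ ?_, fun t t' s ↦ ?_⟩
  · obtain ⟨-, hw⟩ := hget t t' s hsD
    have hw' : Encl.within (E t t' s) (tab t t' s) = true := by
      rcases hw with hlt | hw
      · omega
      · exact hw
    have hm := Encl.mem_of_within hw' (hE t t' s hs2 hsD)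
    unfold tabMid tabRad
    rw [if_pos hsD, if_pos hsD]
    exact abs_sub_mid_le_of_mem_loc hS hm
  · unfold tabRad
    by_cases hsD : s ≤ 2 * D
    · rw [if_pos hsD, if_pos hsD, (hget t t' s hsD).1]
    · rw [if_neg hsD, if_neg hsD]

end CinfCoeff

end Summit.RiemannHypothesis.RiemannHypothesis.Theorems.WeilFormatC
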